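import Summits.QuantumFields.YangMills.Theorems.BalabanUVNodesN21GibbsBlockSupHazard

/-!
# N21 (NE7c) · ROAD II LEFTWARD (lens Card 65 ∕ ROW L): non-collapse to the LEFT of the shell — instantiable on CUT laws —
# and its knit with the PRE-SHELL COUNT in place of the number of variables

R134 seat pub-ymgap-dag-n21-d (g8), node N21 = NE7c (single-run shell-weight bound, NOT PRINTED in [Bałaban 1983–89],
NOT proved), lane K3⁷ `SpineGivenEndpointR13SepCoPH` (stmt-QuantumFields-20544, `--kind proof --supports … --as helper`).
Part 14 of the comparison series.  §L = LENS ROW L of `ym-lens-BalabanUVNodes-nearmiss/LENS-nearmiss.md` v22.0 (Card 65,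
first refusal dag-n21-d): the §L section of the lens's `Sketch-nearmiss-g22.lean` (farm rc 0 at the lens desk) VERBATIM —
statements and proofs — re-homed in this namespace; AUTHORSHIP OF §L's MATHEMATICS: planner seat
`ym-lens-BalabanUVNodes-nearmiss` g22 (memo-only seat, cannot file); this seat files it and adds §K (its own).

ROW L's QUESTION — «WHICH LAW does the hazard chain (parts 7–13) instantiate on?»  ANSWER (this seat): the RIGHTWARD
devices (parts 8–10, 12, 13) are stated for the law WITHOUT the slot's own cut — `T4ShellMeasure.SlotAntiConcentration`'s
own reading (:598, «under the run's positive measure … with the slot's own indicator factor removed, or the fibre of the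
slot's pending operation»), all OTHER cuts riding along as sub-level events (part 9 §1 ∕ part 12 §2 allow any density
`g`, cuts included, and any conditioning event of the other variables); the transfer to the CUT law of the term is
part 11 (`slotAntiConcentration_restrict_of_hazard_largeField`: (M1) constant = hazard constant × large-field odds of
the un-cut fibre law — a displayed (LF) input of [LF-I]'s species).  On the TRUE undecomposed law the slope bound above
`θ` at a level-`j` slot would be a renormalised input — NOT claimed anywhere in the chain.  The lens is right that the
rightward hypothesis is VOID on a law carrying `𝟙_{u<θ}` itself (§L `nonCollapse_right_forces_zero`); §L's LEFT device
is the term-wise alternative, and §K below removes its union-bound constant `n·c`: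

* §L (lens, verbatim): `nonCollapse_right_forces_zero`; `setLIntegral_Ico_le_of_nonCollapse_left` ∕
  `withDensity_Ico_le_Iio_of_nonCollapse_left` (shell mass `≤ M(b−a)∕δ ×` the mass on `[a−δ, b)`, INSIDE `{u < b}`);
  `setOf_shell_iSup_subset`, `measure_shell_iSup_le_sum`, `slotAntiConcentration_iSup_of_marginal_shells` (`D = n·c`).
* §K (this seat): the union bound KEEPING THE SUB-THRESHOLD EVENT (`setOf_shell_iSup_subset_inter`,
  `measure_shell_iSup_le_sum_inter`) and the Tonelli knit on `ℝ^ι` for ANY density `g` — cut laws included — under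
  fibrewise LEFT non-collapse (part 9 §1 `measure_coordSlice_le_of_fibrewise` with `S₁ = [a,b)`, `T₁ = [a−δ, b)`; the
  conditioning event `{x_q < b, q ≠ p}` does not read `x_p`, and moving DOWN the fibre never exits it):
  `ν{a ≤ ⨆ x < b} ≤ M(b−a)∕δ · Σ_p ν({a−δ ≤ x_p < b} ∩ {x_q < b ∀ q ≠ p})`
  (`measure_shell_iSup_le_preShellCount`) — the sum is the EXPECTED NUMBER OF PRE-SHELL VARIABLES on the sub-threshold
  event, so `T4ShellMeasure.SlotAntiConcentration ν (⨆) θ ρ (M·θ·N̄∕δ)` with `N̄` = that expectation relative to the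
  mass (`slotAntiConcentration_iSup_of_preShellCount`).  For a cut small-field Gibbs law read far in the tail
  (`θ ≫` typical field), `δ = θ∕2` and `M = 1` (action nondecreasing beyond the mode) give `D = 2N̄∕… ` with
  `N̄ ≤ n × (half-threshold large-field probability)`: the n-dependence is honest but carries the small factor of
  print's species (`ν̄·e^{−c·p₀(g)²}`-type); nothing of this is asserted for Bałaban's measure.

HONEST FRAMING.  [textbook] measure theory on `ℝ` and on finite products; 0 def, 0 sorry; every located input is a
displayed hypothesis; NE7c NOT PRINTED ∕ NOT proved; N21 NOT discharged; counts unmoved (typed 28∕28 · discharged 5∕27);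
count-neutral; one finite 𝕋⁴ at fixed ε — nothing about ℝ⁴ ∕ OS ∕ mass gap ∕ Clay.
-/

open MeasureTheory Set Function
open scoped ENNReal NNReal

namespace Summit.QuantumFields.YangMills.Theorems.N21LeftNonCollapseHazard

open Literature.MathematicalPhysics.QuantumFieldTheory.Balaban1983to89.T4ShellMeasure (SlotAntiConcentration)
open Summit.QuantumFields.YangMills.Theorems.N21GibbsBlockSupHazard (measure_coordSlice_le_of_fibrewise)

/-! ## §L (lens `Sketch-nearmiss-g22.lean` §L, VERBATIM, credited) — Card 65: road II leftward: non-collapse to the LEFT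
of the shell, instantiable on cut laws -/

section LeftDevice

/-- **THE NEAR-MISS OF THE RIGHTWARD DEVICE ON A CUT LAW.**  If the density vanishes at and above `b` (every term whose
small-field region contains the slot: `𝟙_{u < θ}` is a factor), part 8's rightward non-collapse hypothesis on `[a, b)`
forces the density to vanish on the top layer `[b − δ, b)` of the shell: the device is instantiable only by terms with
NO mass near the threshold. [textbook] -/
theorem nonCollapse_right_forces_zero {f : ℝ → ℝ≥0∞} {a b δ : ℝ} {M : ℝ≥0∞}
    (h : ∀ x ∈ Ico a b, ∀ y ∈ Icc x (x + δ), f x ≤ M * f y) (hcut : ∀ y, b ≤ y → f y = 0) :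
    ∀ x ∈ Ico a b, b - δ ≤ x → f x = 0 := by
  intro x hx hxδ
  have hb : f x ≤ M * f b := h x hx b ⟨hx.2.le, by linarith⟩
  rw [hcut b le_rfl, mul_zero] at hb
  exact le_zero_iff.mp hb

/-- **LEFT NON-COLLAPSE ⇒ THE SHELL IS DOMINATED BY THE MASS JUST BELOW IT (integral form).**  `f(x) ≤ M·f(y)` for
`x ∈ [a, b)`, `y ∈ [x − δ, x]` (`δ > 0`) ⇒ `∫_{[a,b)} f ≤ M(b − a)∕δ · ∫_{[a−δ, b)} f` — the reference window lies INSIDE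
`{u < b}`, where a cut law is untouched. (Mirror of part 8 §1.) [textbook] -/
theorem setLIntegral_Ico_le_of_nonCollapse_left {f : ℝ → ℝ≥0∞} (hf : Measurable f) {a b δ : ℝ}
    (hδ : 0 < δ) (M : ℝ≥0∞) (h : ∀ x ∈ Ico a b, ∀ y ∈ Icc (x - δ) x, f x ≤ M * f y) :
    ∫⁻ x in Ico a b, f x ≤ M * ENNReal.ofReal ((b - a) / δ) * ∫⁻ y in Ico (a - δ) b, f y := by
  set I := ∫⁻ y in Ico (a - δ) b, f y with hI
  have hδ0 : ENNReal.ofReal δ ≠ 0 := (ENNReal.ofReal_pos.2 hδ).ne'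
  have hδtop : ENNReal.ofReal δ ≠ ⊤ := ENNReal.ofReal_ne_top
  have hpt : ∀ x ∈ Ico a b, f x ≤ (ENNReal.ofReal δ)⁻¹ * (M * I) := by
    intro x hx
    have hsub : Icc (x - δ) x ⊆ Ico (a - δ) b :=
      fun y hy => ⟨by linarith [hx.1, hy.1], lt_of_le_of_lt hy.2 hx.2⟩
    have h1 : ENNReal.ofReal δ * f x ≤ M * I := by
      calc ENNReal.ofReal δ * f x = ∫⁻ _ in Icc (x - δ) x, f x := by
            rw [setLIntegral_const, Real.volume_Icc, mul_comm]
            congr 2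
            ring
        _ ≤ ∫⁻ y in Icc (x - δ) x, M * f y := setLIntegral_mono' measurableSet_Icc fun y hy => h x hx y hy
        _ = M * ∫⁻ y in Icc (x - δ) x, f y := lintegral_const_mul M hf
        _ ≤ M * I := mul_le_mul_right (lintegral_mono_set hsub) _
    calc f x = (ENNReal.ofReal δ)⁻¹ * (ENNReal.ofReal δ * f x) := by
          rw [← mul_assoc, ENNReal.inv_mul_cancel hδ0 hδtop, one_mul]
      _ ≤ (ENNReal.ofReal δ)⁻¹ * (M * I) := mul_le_mul_right h1 _
  calc ∫⁻ x in Ico a b, f x ≤ ∫⁻ _ in Ico a b, (ENNReal.ofReal δ)⁻¹ * (M * I) :=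
        setLIntegral_mono' measurableSet_Ico hpt
    _ = (ENNReal.ofReal δ)⁻¹ * (M * I) * ENNReal.ofReal (b - a) := by rw [setLIntegral_const, Real.volume_Ico]
    _ = M * ENNReal.ofReal ((b - a) / δ) * I := by
        rw [ENNReal.ofReal_div_of_pos hδ, div_eq_mul_inv]
        ring

/-- **LEFT NON-COLLAPSE ⇒ WINDOWED BOUND RELATIVE TO `{u < b}` (measure form).**  For the law `volume.withDensity f`:
`μ[a, b) ≤ M(b − a)∕δ · μ(−∞, b)` — the reference event is the SUB-threshold event, on which a cut term lives. [textbook] -/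
theorem withDensity_Ico_le_Iio_of_nonCollapse_left {f : ℝ → ℝ≥0∞} (hf : Measurable f) {a b δ : ℝ}
    (hδ : 0 < δ) (M : ℝ≥0∞) (h : ∀ x ∈ Ico a b, ∀ y ∈ Icc (x - δ) x, f x ≤ M * f y) :
    volume.withDensity f (Ico a b) ≤ M * ENNReal.ofReal ((b - a) / δ) * volume.withDensity f (Iio b) := by
  rw [withDensity_apply _ measurableSet_Ico, withDensity_apply _ measurableSet_Iio]
  exact (setLIntegral_Ico_le_of_nonCollapse_left hf hδ M h).trans
    (mul_le_mul_right (lintegral_mono_set fun y hy => hy.2) _)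

variable {Ω ι : Type*} [MeasurableSpace Ω] [Fintype ι] [Nonempty ι]

omit [MeasurableSpace Ω] in
/-- the shell event of a finite maximum lies in the union of the coordinates' shell events. [textbook] -/
theorem setOf_shell_iSup_subset (v : ι → Ω → ℝ) (a b : ℝ) :
    {x | a ≤ ⨆ p, v p x ∧ ⨆ p, v p x < b} ⊆ ⋃ p, {x | a ≤ v p x ∧ v p x < b} := by
  intro x hx
  obtain ⟨p, hp⟩ := exists_eq_ciSup_of_finite (f := fun p => v p x)
  simp only [mem_iUnion, mem_setOf_eq]
  refine ⟨p, ?_, ?_⟩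
  · rw [hp]; exact hx.1
  · rw [hp]; exact hx.2

/-- **THE LEFTWARD KNIT IS THE UNION BOUND** (n-dependent, `n` = tested variables per slot; contrast part 7's n-free
first-exceedance induction, which is RIGHT-relative). [textbook] -/
theorem measure_shell_iSup_le_sum (ν : Measure Ω) (v : ι → Ω → ℝ) (a b : ℝ) :
    ν {x | a ≤ ⨆ p, v p x ∧ ⨆ p, v p x < b} ≤ ∑ p, ν {x | a ≤ v p x ∧ v p x < b} :=
  (measure_mono (setOf_shell_iSup_subset v a b)).trans (measure_iUnion_fintype_le ν _)

/-- **(M1) FOR THE MAXIMUM FROM PER-VARIABLE SHELL BOUNDS, constant `n·c`** — the shape the LEFT device delivers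
term-wise (each variable's shell mass `≤ c·ρ ×` total mass). [textbook] -/
theorem slotAntiConcentration_iSup_of_marginal_shells (ν : Measure Ω) (v : ι → Ω → ℝ) {θ ρ c : ℝ}
    (h : ∀ p, ν {x | θ * (1 - ρ) ≤ v p x ∧ v p x < θ} ≤ ENNReal.ofReal (c * ρ) * ν univ) :
    SlotAntiConcentration ν (fun x => ⨆ p, v p x) θ ρ (Fintype.card ι * c) := by
  unfold SlotAntiConcentration
  calc ν {x | θ * (1 - ρ) ≤ (⨆ p, v p x) ∧ (⨆ p, v p x) < θ}
      ≤ ∑ p, ν {x | θ * (1 - ρ) ≤ v p x ∧ v p x < θ} := measure_shell_iSup_le_sum ν v _ _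
    _ ≤ ∑ _p : ι, ENNReal.ofReal (c * ρ) * ν univ := Finset.sum_le_sum fun p _ => h p
    _ = ENNReal.ofReal (Fintype.card ι * c * ρ) * ν univ := by
        rw [Finset.sum_const, Finset.card_univ, nsmul_eq_mul, ← mul_assoc, mul_assoc (Fintype.card ι : ℝ),
          ENNReal.ofReal_mul (Nat.cast_nonneg _), ENNReal.ofReal_natCast]

end LeftDevice

/-! ## §K (this seat) — the union bound keeping the sub-threshold event, and the knit with the PRE-SHELL COUNT -/

section PreShell

variable {Ω ι : Type*} [MeasurableSpace Ω] [Fintype ι] [Nonempty ι]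

omit [MeasurableSpace Ω] in
/-- the shell event of the maximum lies in the union of the events «`v p` in its shell AND every other variable below
`b`» (the maximum is below `b`). [textbook] -/
theorem setOf_shell_iSup_subset_inter (v : ι → Ω → ℝ) (a b : ℝ) :
    {x | a ≤ ⨆ p, v p x ∧ ⨆ p, v p x < b}
      ⊆ ⋃ p, ({x | a ≤ v p x ∧ v p x < b} ∩ {x | ∀ q, q ≠ p → v q x < b}) := by
  intro x hx
  have hbdd : BddAbove (Set.range fun p => v p x) := (Set.finite_range _).bddAbove
  obtain ⟨p, hp⟩ := exists_eq_ciSup_of_finite (f := fun p => v p x)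
  simp only [mem_iUnion, mem_inter_iff, mem_setOf_eq]
  refine ⟨p, ⟨?_, ?_⟩, fun q _ => (le_ciSup hbdd q).trans_lt hx.2⟩
  · rw [hp]; exact hx.1
  · rw [hp]; exact hx.2

/-- the union bound with the sub-threshold event kept: `ν{a ≤ ⨆ v < b} ≤ Σ_p ν({a ≤ v p < b} ∩ {v q < b, q ≠ p})`.
[textbook] -/
theorem measure_shell_iSup_le_sum_inter (ν : Measure Ω) (v : ι → Ω → ℝ) (a b : ℝ) :
    ν {x | a ≤ ⨆ p, v p x ∧ ⨆ p, v p x < b}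
      ≤ ∑ p, ν ({x | a ≤ v p x ∧ v p x < b} ∩ {x | ∀ q, q ≠ p → v q x < b}) :=
  (measure_mono (setOf_shell_iSup_subset_inter v a b)).trans (measure_iUnion_fintype_le ν _)

end PreShell

section Knit

variable {ι : Type*} [Fintype ι] [DecidableEq ι] [Nonempty ι]

/-- **THE SHELL OF THE MAXIMUM IS CARRIED BY THE PRE-SHELL COUNT.**  `ν = (pi volume).withDensity g` on `ℝ^ι`, `g` ANY
measurable density (CUT laws `g = e^{−A}·𝟙_{…}` included); if along every `p`-fibre the density does not collapse to
the LEFT of the shell, `g(x_p := y₁) ≤ M·g(x_p := y₂)` for `y₁ ∈ [a, b)`, `y₂ ∈ [y₁ − δ, y₁]` (uniformly in the other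
coordinates), then
`ν{a ≤ ⨆ x < b} ≤ M(b−a)∕δ · Σ_p ν({a − δ ≤ x_p < b} ∩ {x_q < b, q ≠ p})` — the sum being the expected number of
PRE-SHELL variables on the sub-threshold event (§L per fibre + part 9 §1's Tonelli; moving DOWN a fibre never exits
`{x_q < b, q ≠ p}`). [textbook] -/
theorem measure_shell_iSup_le_preShellCount {g : (ι → ℝ) → ℝ≥0∞} (hg : Measurable g) {a b δ M : ℝ}
    (hδ : 0 < δ) (hM : 0 ≤ M)
    (hnc : ∀ p (x : ι → ℝ), ∀ y₁ ∈ Ico a b, ∀ y₂ ∈ Icc (y₁ - δ) y₁,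
      g (update x p y₁) ≤ ENNReal.ofReal M * g (update x p y₂)) :
    (Measure.pi fun _ : ι => (volume : Measure ℝ)).withDensity g {x | a ≤ ⨆ p, x p ∧ ⨆ p, x p < b}
      ≤ ENNReal.ofReal (M * ((b - a) / δ)) *
        ∑ p, (Measure.pi fun _ : ι => (volume : Measure ℝ)).withDensity g
          ({x | a - δ ≤ x p ∧ x p < b} ∩ {x | ∀ q, q ≠ p → x q < b}) := by
  refine (measure_shell_iSup_le_sum_inter _ (fun p (x : ι → ℝ) => x p) a b).trans ?_
  rw [Finset.mul_sum]
  refine Finset.sum_le_sum fun p _ => ?_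
  -- the conditioning event of the OTHER coordinates does not read `x_p`
  have hC : MeasurableSet {x : ι → ℝ | ∀ q, q ≠ p → x q < b} := by
    have : {x : ι → ℝ | ∀ q, q ≠ p → x q < b} = ⋂ q, {x | q ≠ p → x q < b} := by
      ext x; simp only [mem_setOf_eq, mem_iInter]
    rw [this]
    refine MeasurableSet.iInter fun q => ?_
    by_cases hq : q = p
    · have : {x : ι → ℝ | q ≠ p → x q < b} = univ := by
        ext x; simp [hq]
      rw [this]; exact MeasurableSet.univ
    · have : {x : ι → ℝ | q ≠ p → x q < b} = {x | x q < b} := by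
        ext x; simp [hq]
      rw [this]; exact measurableSet_lt (measurable_pi_apply q) measurable_const
  have hCp : ∀ (x : ι → ℝ) (y : ℝ),
      update x p y ∈ {x : ι → ℝ | ∀ q, q ≠ p → x q < b} ↔ x ∈ {x : ι → ℝ | ∀ q, q ≠ p → x q < b} := by
    intro x y
    simp only [mem_setOf_eq]
    refine forall_congr' fun q => forall_congr' fun hq => ?_
    rw [update_of_ne hq]
  -- the fibrewise LEFT bound (§L) along the `p`-fibre through `x`
  have hfib : ∀ x : ι → ℝ, ∫⁻ y in Ico a b, g (update x p y)
      ≤ ENNReal.ofReal (M * ((b - a) / δ)) * ∫⁻ y in Ico (a - δ) b, g (update x p y) := by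
    intro x
    have hgx : Measurable fun y => g (update x p y) := hg.comp (measurable_update x)
    have h := setLIntegral_Ico_le_of_nonCollapse_left hgx hδ (ENNReal.ofReal M)
      (fun y₁ hy₁ y₂ hy₂ => hnc p x y₁ hy₁ y₂ hy₂)
    rwa [← ENNReal.ofReal_mul hM] at h
  exact measure_coordSlice_le_of_fibrewise hg p measurableSet_Ico measurableSet_Ico _ ENNReal.ofReal_ne_top
    hfib hC hCp

/-- **(M1) FOR THE MAXIMUM WITH THE PRE-SHELL COUNT IN PLACE OF `n`.**  Under fibrewise LEFT non-collapse by `M` within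
`δ` below the shell `[θ(1−ρ), θ)` and the PRE-SHELL COUNT bound
`Σ_p ν({θ(1−ρ) − δ ≤ x_p < θ} ∩ {x_q < θ, q ≠ p}) ≤ N̄ · ν(univ)`:
`T4ShellMeasure.SlotAntiConcentration ν (x ↦ ⨆ p, x p) θ ρ (M·θ·N̄∕δ)` — for ANY density, cut laws included.  `N̄ ≤ n`
always (§L's union bound); for a cut small-field Gibbs law read far in the tail, `N̄ ≤ n ×` a half-threshold
large-field probability (displayed, not asserted). [textbook] -/
theorem slotAntiConcentration_iSup_of_preShellCount {g : (ι → ℝ) → ℝ≥0∞} (hg : Measurable g) {θ ρ δ M N : ℝ}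
    (hδ : 0 < δ) (hM : 0 ≤ M) (hθρ : 0 ≤ θ * ρ)
    (hnc : ∀ p (x : ι → ℝ), ∀ y₁ ∈ Ico (θ * (1 - ρ)) θ, ∀ y₂ ∈ Icc (y₁ - δ) y₁,
      g (update x p y₁) ≤ ENNReal.ofReal M * g (update x p y₂))
    (hcount : ∑ p, (Measure.pi fun _ : ι => (volume : Measure ℝ)).withDensity g
        ({x | θ * (1 - ρ) - δ ≤ x p ∧ x p < θ} ∩ {x | ∀ q, q ≠ p → x q < θ})
      ≤ ENNReal.ofReal N * (Measure.pi fun _ : ι => (volume : Measure ℝ)).withDensity g univ) :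
    SlotAntiConcentration ((Measure.pi fun _ : ι => (volume : Measure ℝ)).withDensity g)
      (fun x => ⨆ p, x p) θ ρ (M * θ * N / δ) := by
  unfold SlotAntiConcentration
  have h := measure_shell_iSup_le_preShellCount hg hδ hM hnc (a := θ * (1 - ρ)) (b := θ)
  have hc : 0 ≤ M * ((θ - θ * (1 - ρ)) / δ) := mul_nonneg hM (div_nonneg (by nlinarith) hδ.le)
  refine h.trans ((mul_le_mul_right hcount _).trans (le_of_eq ?_))
  rw [← mul_assoc, ← ENNReal.ofReal_mul hc]
  congr 2
  field_simp
  ring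

omit [Fintype ι] [Nonempty ι] in
/-- **`M = 1` BEYOND THE MODE.**  For a density `e^{−A}·R` whose action `A` is nondecreasing along the `p`-fibre on the
left `δ`-neighbourhoods of the shell (the shell sits beyond the mode of the fibre law — a small-field Gibbs law read far
in the tail) and whose remaining factor `R` does not decrease when `x_p` decreases there (cuts `𝟙_{x_p < t}`, factors of
the other coordinates), LEFT non-collapse holds with `M = 1`. [textbook] -/
theorem nonCollapse_left_of_monotone {A : (ι → ℝ) → ℝ} {R : (ι → ℝ) → ℝ≥0∞} (p : ι) {a b δ : ℝ}
    (hA : ∀ (x : ι → ℝ), ∀ y₁ ∈ Ico a b, ∀ y₂ ∈ Icc (y₁ - δ) y₁, A (update x p y₂) ≤ A (update x p y₁))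
    (hR : ∀ (x : ι → ℝ), ∀ y₁ ∈ Ico a b, ∀ y₂ ∈ Icc (y₁ - δ) y₁, R (update x p y₁) ≤ R (update x p y₂)) :
    ∀ (x : ι → ℝ), ∀ y₁ ∈ Ico a b, ∀ y₂ ∈ Icc (y₁ - δ) y₁,
      (fun z => ENNReal.ofReal (Real.exp (-A z)) * R z) (update x p y₁)
        ≤ ENNReal.ofReal 1 * (fun z => ENNReal.ofReal (Real.exp (-A z)) * R z) (update x p y₂) := by
  intro x y₁ hy₁ y₂ hy₂
  simp only [ENNReal.ofReal_one, one_mul]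
  refine mul_le_mul' (ENNReal.ofReal_le_ofReal (Real.exp_le_exp.2 ?_)) (hR x y₁ hy₁ y₂ hy₂)
  linarith [hA x y₁ hy₁ y₂ hy₂]

/-- **(M1) BEYOND THE MODE: constant `θ·N̄∕δ`.**  For `ν = (e^{−A}·R) dx` with `A` nondecreasing and `R` non-decreasing
downwards along each fibre on the left `δ`-neighbourhoods of the shell `[θ(1−ρ), θ)`, and the pre-shell count bound
`≤ N̄ · ν(univ)`: `T4ShellMeasure.SlotAntiConcentration ν (x ↦ ⨆ p, x p) θ ρ (θ·N̄∕δ)` (e.g. `δ = θ∕2`: `D = 2N̄`).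
[textbook] -/
theorem slotAntiConcentration_iSup_of_monotone_preShellCount {A : (ι → ℝ) → ℝ} (hA : Measurable A)
    {R : (ι → ℝ) → ℝ≥0∞} (hR : Measurable R) {θ ρ δ N : ℝ} (hδ : 0 < δ) (hθρ : 0 ≤ θ * ρ)
    (hAm : ∀ p (x : ι → ℝ), ∀ y₁ ∈ Ico (θ * (1 - ρ)) θ, ∀ y₂ ∈ Icc (y₁ - δ) y₁,
      A (update x p y₂) ≤ A (update x p y₁))
    (hRm : ∀ p (x : ι → ℝ), ∀ y₁ ∈ Ico (θ * (1 - ρ)) θ, ∀ y₂ ∈ Icc (y₁ - δ) y₁,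
      R (update x p y₁) ≤ R (update x p y₂))
    (hcount : ∑ p, (Measure.pi fun _ : ι => (volume : Measure ℝ)).withDensity
        (fun z => ENNReal.ofReal (Real.exp (-A z)) * R z)
        ({x | θ * (1 - ρ) - δ ≤ x p ∧ x p < θ} ∩ {x | ∀ q, q ≠ p → x q < θ})
      ≤ ENNReal.ofReal N * (Measure.pi fun _ : ι => (volume : Measure ℝ)).withDensity
        (fun z => ENNReal.ofReal (Real.exp (-A z)) * R z) univ) :
    SlotAntiConcentration
      ((Measure.pi fun _ : ι => (volume : Measure ℝ)).withDensity fun z => ENNReal.ofReal (Real.exp (-A z)) * R z)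
      (fun x => ⨆ p, x p) θ ρ (θ * N / δ) := by
  have hg : Measurable fun z : ι → ℝ => ENNReal.ofReal (Real.exp (-A z)) * R z :=
    (ENNReal.measurable_ofReal.comp (Real.measurable_exp.comp hA.neg)).mul hR
  have h := slotAntiConcentration_iSup_of_preShellCount hg hδ zero_le_one hθρ
    (fun p x y₁ hy₁ y₂ hy₂ => nonCollapse_left_of_monotone p (hAm p) (hRm p) x y₁ hy₁ y₂ hy₂) hcount (M := 1) (N := N)
  simpa only [one_mul] using h

end Knit

end Summit.QuantumFields.YangMills.Theorems.N21LeftNonCollapseHazard
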